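import Summits.QuantumFields.YangMills.Theorems.AlphaInputsT3ACv4CoreRows
import HarnessLib

/-!
# `AlphaInputsT3ACv4ChiInt` — THE v4 χ-PACKAGE'S INTERIOR (47)′ ROWS: the version-4 twin of ✓ `AlphaInputsT3ACv3Chi` §3 (`PkgAtV3Chi.ineq47Print_ae ∕ intWindowT3_subset_loPrintAC ∕
# ineq47Int_ae ∕ le_resDensity_int_ae`) for `AlphaInputsT3AC.PkgAtV4Chi` — the ONE χ-package row the crux's door `…LaneTailV4Chi` reads — lane `pub-balaban3d`, width seat alpha-2 (g7),
# v4 package plan (★★OWNER RULING g26-№14; alpha-2 = package owner)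

WHY (cell `ym3-torus`, route `UnitScaleTilt`, crux `HistoryTailL` = stmt-QuantumFields-19936).  The v3 door ✓ `UnitScaleTiltHistoryTailLaneTailChi` instantiates the record-free
interior socket with the χ-package and reads EXACTLY ONE χ-row: `PkgAtV3Chi.le_resDensity_int_ae` ((47)′ for the route's density with the INTERIOR indicator `𝟙[intWindowT3 j]`,
constants pulled out), proved in ✓ `…v3Chi` §3 from the χ step packages' `fibre57LowOn` rows (`AlphaV3AC.ineq47On_ae_of_alphaV3Chi`) and the record's row r1 (the interior window
lies in print's validity family).  The v4 χ-package `PkgAtV4Chi` (✓ `…v4Chi`, run rows `RunAlphaV4ChiAC`: χ step packages UNCHANGED, `hLF67 ↦ h71`) needs the same rows for the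
v4 door; ✓ `…v4Chi` ported the socket and the choosers only.  THIS FILE supplies them, def-free:
* §1 ★ `AlphaV4AC.ineq47On_ae_of_alphaV4Chi` — lane-generic (47) on print's validity family, `dV`-a.e., every `j ≤ K`, from `RunAlphaV4ChiAC` (✓ `ineq47On_ae_of_alphaV3Chi`'s
  proof reads ONLY the step packages `R.steps` and the `≤`-window — VERBATIM over v4);
* §2 over the ROWS record `q : AlphaInputsT3AC.PkgCoreRows` (✓ `…v4CoreRows`; core data only): `PkgCoreRows.intWindowT3_subset_loPrintAC_aux ∕ intWindowT3_subset_loPrintAC`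
  (the interior window lies in print's family: `j = 0` by `U_0 = id`, `j ≥ 1` by row r1 at the free radius `θ/max(B₃,1)`);
* §3 over the v4 χ-package `p : AlphaInputsT3AC.PkgAtV4Chi` (letters `p.toRows.X ∕ .T ∕ .E`): `PkgAtV4Chi.ineq47Print_ae`, `ineq47Int_ae`, ★ `le_resDensity_int_ae` — the TEXTS
  of the v3 rows with `p.toCore ↦ p.toRows`, so the door's `dataIntRows_ineq47AE_of_chi (qf : ∀ K, PkgCoreRows …) (p : PkgAtV4Chi …) (hp : qf K = p.toRows)` ports by renaming.
HONEST FRAMING.  Re-reads of landed theorems over the additive v4 records; (47) itself is the χ step packages' HYPOTHESIS row `fibre57LowOn` (print's Thm 2, displayed, not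
proved); nothing of the cluster expansion or of [Balaban1985Variational] Thm 1 is proved here.  Count-neutral helper (`--supports stmt-QuantumFields-19936`); registry
untouched.  YM₃ on the three-torus is rung R3 of the programme, NOT the Clay problem: nothing here bears on d = 4, infinite volume, or a mass gap.

References: T. Bałaban, Commun. Math. Phys. 102 (1985) 255–275 [Balaban1985UV3] ((5) p.256, (47) p.267, p.272 L32–33, Thm 2 p.272); Commun. Math. Phys. 102 (1985)
277–309 [Balaban1985Variational] (Thm 1 (8) p.279).
-/

set_option autoImplicit false

noncomputable section

/-! ## §1 Lane-generic: (47) on print's validity family from the v4 χ-record's rows -/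

namespace Summit.QuantumFields.YangMills.Theorems.AlphaV4AC

open MeasureTheory
open scoped BigOperators
open Literature.MathematicalPhysics.QuantumFieldTheory.Balaban1983to89
open Literature.MathematicalPhysics.QuantumFieldTheory.Balaban1983to89.B10
open Literature.MathematicalPhysics.QuantumFieldTheory.Balaban1985CMP102
open Literature.MathematicalPhysics.QuantumFieldTheory.Balaban1985CMP102.Setting
open Summit.QuantumFields.Balaban3D.Carriers
open Summit.QuantumFields.Balaban3D.Proofs.Primitives
open Summit.QuantumFields.Balaban3D.Proofs.GroupModelLieC (lieC)
open Summit.QuantumFields.Balaban3D.Proofs.TowerAC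
open Summit.QuantumFields.Balaban3D.Proofs.StandardAC
open Summit.QuantumFields.Balaban3D.Proofs.InputsAC
open Summit.QuantumFields.Balaban3D.Proofs.AlphaAC
open Summit.QuantumFields.YangMills.Theorems.AlphaV3AC

section AlphaTower

variable {L : ℕ} {S : Scales L} {G : Type} [GaugeGroup G] [MeasurableSpace G] [HaarData G] {𝔊 : GroupModel G} {𝔠 : AlphaConsts L 𝔊.N}
  {X : ExternalInputsAC S G} {𝔖 : ∀ k, StepSeries S G ↥(lieC 𝔊) (nblkOf S 𝔠.lane.carrier k) k} {𝔄 : AlphaDataAC 𝔊 𝔠 X 𝔖}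
  {win : (k : ℕ) → Hist S.P (k + 1) → Set (GaugeField S.P (k + 1) G)}

/-- ★ **BAŁABAN CMP 102 (47) ON PRINT'S VALIDITY FAMILY, `dV`-A.E., EVERY `j ≤ K`, MODULO THE v4 χ-RECORD'S ROWS**: on the `≤`-family `g²ε₀ ≤ (min γ₀ 1)²`, `RunAlphaV4ChiAC` gives
`𝟙[loPrintAC j](V)·exp(−mainT_j(triv,V) + Pint_j(triv,V) − E_j − Rm_j) ≤ ρ_j(V)` for `dV`-a.e. `V` — `AlphaV3AC.ineq47On_ae_of_alphaV3Chi` VERBATIM over the v4 record (its proof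
reads only the χ step packages `R.steps`, unchanged in v4: `PinnedStep.ineq47On_ae` fed by `fibre57LowOn`, the χ-free exponent step from the seven leaves, the data rows
`hU`∕`hPm`∕`hPb`). [cite: Balaban1985UV3, (47) p.267 + p.272 L32–33 + Thm 2 p.272] -/
theorem ineq47On_ae_of_alphaV4Chi (hle : S.g ^ 2 * S.ε₀ ≤ (min 𝔠.gamma0 1) ^ 2) (R : RunAlphaV4ChiAC 𝔊 𝔠 X 𝔖 𝔄 win)
    (hUK : Measurable (X.UkH S.K (Hist.triv S.P S.K))) (hPmK : Measurable ((inputOfAC 𝔠.lane X 𝔖).Pint S.K (Hist.triv S.P S.K)))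
    (hPbK : ∀ U : GaugeField S.P S.K G, (inputOfAC 𝔠.lane X 𝔖).Pint S.K (Hist.triv S.P S.K) U ≤ 𝔄.cP S.K) :
    ∀ j : ℕ, j ≤ S.K → ∀ᵐ V ∂(fieldMeasure S.P j G),
      (PinnedStep.loPrintAC 𝔠.lane X j).indicator (fun _ => (1 : ℝ)) V *
          Real.exp (-((towerOfAC 𝔠.lane X 𝔖).mainT j (Hist.triv S.P j) V) + (towerOfAC 𝔠.lane X 𝔖).Pint j (Hist.triv S.P j) V
            - (towerOfAC 𝔠.lane X 𝔖).Ecst j - (towerOfAC 𝔠.lane X 𝔖).Rm j) ≤ (towerOfAC 𝔠.lane X 𝔖).ρ j V := by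
  haveI : RegularGaugeGroup G := groupModel_regularGaugeGroup 𝔊
  have RC := R.toCore
  -- the data rows at every `k ≤ K` (step rows for `k < K`, terminal rows at `k = K`)
  have hU : ∀ k, k ≤ S.K → Measurable (X.UkH k (Hist.triv S.P k)) := fun k hk => by
    rcases Nat.lt_or_eq_of_le hk with hlt | heq
    · exact (RC.steps k hlt).hU _
    · subst heq; exact hUK
  have hPm : ∀ k, k ≤ S.K → Measurable ((inputOfAC 𝔠.lane X 𝔖).Pint k (Hist.triv S.P k)) := fun k hk => by
    rcases Nat.lt_or_eq_of_le hk with hlt | heq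
    · exact (RC.steps k hlt).hPm _
    · subst heq; exact hPmK
  have hPb : ∀ k, k ≤ S.K → ∃ cP : ℝ, ∀ U : GaugeField S.P k G, (inputOfAC 𝔠.lane X 𝔖).Pint k (Hist.triv S.P k) U ≤ cP := fun k hk => by
    rcases Nat.lt_or_eq_of_le hk with hlt | heq
    · exact ⟨𝔄.cP k, fun U => (RC.steps k hlt).hPb _ U⟩
    · subst heq; exact ⟨𝔄.cP S.K, hPbK⟩
  exact PinnedStep.ineq47On_ae 𝔠.lane X 𝔖 (PinnedStep.loPrintAC 𝔠.lane X)
    (fun k hk => PinnedStep.measurableSet_loPrintAC 𝔠.lane X k (hU k hk))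
    (fun k hk => (R.steps k hk).fibre57LowOn)
    (fun k hk V => expo47_succ_le_expo57_CoreAC 𝔠.lane X 𝔖 k hk (stepResidualsV3Core_of_alpha hle k hk (RC.steps k hk)) V)
    hU hPm hPb

end AlphaTower

end Summit.QuantumFields.YangMills.Theorems.AlphaV4AC

/-! ## §2 The interior window lies in print's validity family — over the rows record (core data only) -/

namespace Summit.QuantumFields.YangMills.Theorems

open MeasureTheory
open scoped BigOperators
open Literature.MathematicalPhysics.QuantumFieldTheory.Balaban1983to89
open Literature.MathematicalPhysics.QuantumFieldTheory.Balaban1983to89.T3ContinuumYM3Torus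
open Literature.MathematicalPhysics.QuantumFieldTheory.Balaban1983to89.T3UnitScaleTilt (θBal)
open Literature.MathematicalPhysics.QuantumFieldTheory.Balaban1983to89.T3LevelShift (fieldShift)
open Literature.MathematicalPhysics.QuantumFieldTheory.Balaban1983to89.T3PrintedRegularMinimiser (regFibrePr)
open Literature.MathematicalPhysics.QuantumFieldTheory.Balaban1983to89.T3RestrictedUnitDensity (resDensity)
open Literature.MathematicalPhysics.QuantumFieldTheory.Balaban1983to89.T3RegularMinimiser (regThreshold)
open Literature.MathematicalPhysics.QuantumFieldTheory.Balaban1985CMP102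
open Literature.MathematicalPhysics.QuantumFieldTheory.Balaban1985CMP102.Setting
open Summit.QuantumFields.Balaban3D.Carriers
open Summit.QuantumFields.Balaban3D.Proofs.Primitives
open Summit.QuantumFields.Balaban3D.Proofs.GroupModelLieC (lieC)
open Summit.QuantumFields.Balaban3D.Proofs.TowerAC
open Summit.QuantumFields.Balaban3D.Proofs.StandardAC
open Summit.QuantumFields.Balaban3D.Proofs.InputsAC
open Summit.QuantumFields.Balaban3D.Proofs.AlphaAC (AlphaDataAC)
open Summit.QuantumFields.YangMills.Theorems.AlphaV3AC
open Summit.QuantumFields.YangMills.Theorems.AlphaV4AC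

section Api

variable {F : T3Family} {𝔠 : AlphaConsts F.L (suGroupModel 2).N} {γ : ℝ} {hγ : 0 < γ} {hγ1 : γ ≤ (min 𝔠.gamma0 1) ^ 2} {K : ℕ}

namespace AlphaInputsT3AC.PkgCoreRows

variable (q : AlphaInputsT3AC.PkgCoreRows F 𝔠 γ hγ hγ1 K)

/-- Auxiliary form of the bridge at the levels `K − n`, `n < K` (at least one averaging step), over the ROWS record: the interior window lies in print's family — row r1 at the
FREE radius `θBal(n)/max(B₃,1)` puts the trivial-history minimiser in `𝔘(B₃·θBal(n)/max(B₃,1)) ⊆ 𝔘(θBal(n))` (✓ `PkgAtV3Chi.intWindowT3_subset_loPrintAC_aux` with `p.toCore ↦ q`).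
[cite: Balaban1985Variational, Thm 1 (8) p.279] -/
theorem intWindowT3_subset_loPrintAC_aux (ha₁ : ∀ i, θBal F.L γ 𝔠.b₀ 𝔠.p₀ i ≤ q.a₁) (n : ℕ) (hnK : n < K) :
    AlphaInputsT3AC.intWindowT3 F 𝔠 γ K (K - n) ⊆ PinnedStep.loPrintAC 𝔠.lane q.X (K - n) := by
  have hB1 : 1 ≤ max 𝔠.B₃ 1 := le_max_right _ _
  have hB0 : 0 < max 𝔠.B₃ 1 := lt_of_lt_of_le one_pos hB1
  have hBle : 𝔠.B₃ ≤ max 𝔠.B₃ 1 := le_max_left _ _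
  have hnn : K - (K - n) = n := Nat.sub_sub_self hnK.le
  have hθ : 0 < θBal F.L γ 𝔠.b₀ 𝔠.p₀ n := by
    have := q.θBal_pos (K - n) (Nat.sub_le _ _); rwa [hnn] at this
  have heps : eps1Of (T3Scales F γ hγ (hγ1.trans (sq_min_one_le _ 𝔠.gamma0_pos)) K) 𝔠.lane.carrier (K - n) = θBal F.L γ 𝔠.b₀ 𝔠.p₀ n := by
    have := q.eps1_eq (K - n) (Nat.sub_le _ _); rwa [hnn] at this
  -- the letters of row r1 at the free radius `ε₁ := θ/max(B₃,1)`, `ε₀ := B₃ε₁`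
  set ε₁ : ℝ := θBal F.L γ 𝔠.b₀ 𝔠.p₀ n / max 𝔠.B₃ 1 with hε₁
  have hε₁0 : 0 < ε₁ := div_pos hθ hB0
  have hε₁θ : ε₁ ≤ θBal F.L γ 𝔠.b₀ 𝔠.p₀ n := div_le_self hθ.le hB1
  have hε₁a : ε₁ ≤ q.a₁ := hε₁θ.trans (ha₁ n)
  have hB3ε₁ : 𝔠.B₃ * ε₁ ≤ θBal F.L γ 𝔠.b₀ 𝔠.p₀ n := by
    rw [hε₁]
    calc 𝔠.B₃ * (θBal F.L γ 𝔠.b₀ 𝔠.p₀ n / max 𝔠.B₃ 1) ≤ max 𝔠.B₃ 1 * (θBal F.L γ 𝔠.b₀ 𝔠.p₀ n / max 𝔠.B₃ 1) :=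
          mul_le_mul_of_nonneg_right hBle (div_nonneg hθ.le hB0.le)
      _ = θBal F.L γ 𝔠.b₀ 𝔠.p₀ n := mul_div_cancel₀ _ hB0.ne'
  have hhi : 𝔠.B₃ * ε₁ ≤ q.a₀ := by
    have h1 : 𝔠.B₃ * ε₁ ≤ 𝔠.B₃ * q.a₁ := mul_le_mul_of_nonneg_left hε₁a 𝔠.B₃_pos.le
    exact h1.trans q.consts_ok.2.2
  refine PinnedStep.plaqSmall_subset_loPrintAC 𝔠.lane q.X (K - n) (δ := θBal F.L γ 𝔠.b₀ 𝔠.p₀ (K - (K - n)) / max 𝔠.B₃ 1) ?_ ?_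
  · rw [hnn, heps]; exact hε₁θ
  · intro V hV
    rw [hnn] at hV
    rw [heps, ← q.X.UkH_triv (K - n) V]
    -- shift the datum to height `n`, level `0`, apply row r1, shift back
    let hsh := F.sitesPerDir_eq (m := F.m) (K := K) (j := K - n) (m' := F.m) (K' := n) (j' := 0) (by omega)
    have hV₀ : PlaqSmall ε₁ (fieldShift hsh.symm V) := (T3CruxEstimates.plaqSmall_fieldShift F hsh.symm ε₁ V).mpr hV
    have hr1 := (q.minRows.1 n hnK ε₁ (𝔠.B₃ * ε₁) hε₁0 hε₁a le_rfl hhi (fieldShift hsh.symm V) hV₀).1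
    rw [T3LevelShift.fieldShift_symm_fieldShift] at hr1
    have hreg : PlaqSmall (regThreshold F n K (𝔠.B₃ * ε₁)) (q.UkH (K - n) (Hist.triv (F.P K) (K - n)) V) :=
      ((T3PrintedRegularMinimiser.mem_regFibrePr_iff F).mp hr1).2.1
    intro p
    have hp := hreg p
    refine hp.trans_le ?_
    show 𝔠.B₃ * ε₁ * ((F.L : ℝ)⁻¹) ^ (2 * (K - n)) ≤ θBal F.L γ 𝔠.b₀ 𝔠.p₀ n * ((F.L : ℝ)⁻¹) ^ (2 * (K - n))
    exact mul_le_mul_of_nonneg_right hB3ε₁ (pow_nonneg (inv_nonneg.mpr (Nat.cast_nonneg _)) _)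

/-- **THE INTERIOR WINDOW LIES IN PRINT'S VALIDITY FAMILY, every level `j ≤ K`, over the ROWS record** (`j = 0`: `U_0 = id`; `j ≥ 1`: row r1), under the [Balaban1985Variational]
data-smallness threshold `θBal ≤ a₁`. [cite: Balaban1985Variational, Thm 1 (8) p.279] -/
theorem intWindowT3_subset_loPrintAC (ha₁ : ∀ i, θBal F.L γ 𝔠.b₀ 𝔠.p₀ i ≤ q.a₁) (j : ℕ) (hj : j ≤ K) :
    AlphaInputsT3AC.intWindowT3 F 𝔠 γ K j ⊆ PinnedStep.loPrintAC 𝔠.lane q.X j := by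
  rcases Nat.eq_zero_or_pos j with rfl | hj1
  · have hB1 : 1 ≤ max 𝔠.B₃ 1 := le_max_right _ _
    have hθ : 0 < θBal F.L γ 𝔠.b₀ 𝔠.p₀ (K - 0) := q.θBal_pos 0 (Nat.zero_le _)
    have heps : eps1Of (T3Scales F γ hγ (hγ1.trans (sq_min_one_le _ 𝔠.gamma0_pos)) K) 𝔠.lane.carrier 0 = θBal F.L γ 𝔠.b₀ 𝔠.p₀ (K - 0) :=
      q.eps1_eq 0 (Nat.zero_le _)
    refine PinnedStep.plaqSmall_subset_loPrintAC 𝔠.lane q.X 0 (δ := θBal F.L γ 𝔠.b₀ 𝔠.p₀ (K - 0) / max 𝔠.B₃ 1) ?_ ?_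
    · rw [heps]; exact div_le_self hθ.le hB1
    · intro V hV p
      simp only [mul_zero, pow_zero, mul_one]
      rw [heps]
      exact (hV p).trans_le (div_le_self hθ.le hB1)
  · have h := q.intWindowT3_subset_loPrintAC_aux ha₁ (K - j) (by omega)
    rwa [Nat.sub_sub_self hj] at h

end AlphaInputsT3AC.PkgCoreRows

/-! ## §3 Print's (47) for the v4 χ-package: a.e. on print's family and on the interior field window, and (47)′ for the route's density -/

namespace AlphaInputsT3AC.PkgAtV4Chi

variable (p : AlphaInputsT3AC.PkgAtV4Chi F 𝔠 γ hγ hγ1 K)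

/-- **PRINT'S (47) FOR THE v4 χ-PACKAGE'S TOWER ON PRINT'S VALIDITY FAMILY, `dV`-a.e., every `j ≤ K`** (`AlphaV4AC.ineq47On_ae_of_alphaV4Chi` on the window `T3Scales_window`,
terminal data rows from `termRows`; letters `p.toRows.X ∕ .T`). [cite: Balaban1985UV3, (47) p.267 + Thm 2 p.272] -/
theorem ineq47Print_ae (j : ℕ) (hj : j ≤ K) :
    ∀ᵐ V ∂fieldMeasure (F.P K) j (Matrix.specialUnitaryGroup (Fin 2) ℂ),
      (PinnedStep.loPrintAC 𝔠.lane p.toRows.X j).indicator (fun _ => (1 : ℝ)) V *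
          Real.exp (-(p.toRows.T.mainT j (Hist.triv (F.P K) j) V) + p.toRows.T.Pint j (Hist.triv (F.P K) j) V - p.toRows.T.Ecst j - p.toRows.T.Rm j) ≤
        p.toRows.T.ρ j V :=
  ineq47On_ae_of_alphaV4Chi (T3Scales_window F 𝔠 γ hγ hγ1 K) p.run (p.termRows.1 _) (p.termRows.2.1 _) (p.termRows.2.2 _) j hj

/-- **PRINT'S (47) ON THE INTERIOR FIELD WINDOW, `dV`-a.e., every `j ≤ K`, for the v4 χ-package**: `𝟙[intWindowT3 j](V)·exp(−mainT_j(triv,V) + Pint_j(triv,V) − E_j − Rm_j) ≤ ρ_j(V)`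
a.e. [cite: Balaban1985UV3, (5) p.256 + (47) p.267; Balaban1985Variational, Thm 1 (8) p.279] -/
theorem ineq47Int_ae (ha₁ : ∀ i, θBal F.L γ 𝔠.b₀ 𝔠.p₀ i ≤ p.a₁) (j : ℕ) (hj : j ≤ K) :
    ∀ᵐ V ∂fieldMeasure (F.P K) j (Matrix.specialUnitaryGroup (Fin 2) ℂ),
      (AlphaInputsT3AC.intWindowT3 F 𝔠 γ K j).indicator (fun _ => (1 : ℝ)) V *
          Real.exp (-(p.toRows.T.mainT j (Hist.triv (F.P K) j) V) + p.toRows.T.Pint j (Hist.triv (F.P K) j) V - p.toRows.T.Ecst j - p.toRows.T.Rm j) ≤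
        p.toRows.T.ρ j V :=
  ineq47On_ae_mono (𝔊 := suGroupModel 2) (𝔖 := p.𝔖) (lo' := AlphaInputsT3AC.intWindowT3 F 𝔠 γ K) j
    (p.toRows.intWindowT3_subset_loPrintAC ha₁ j hj) (p.ineq47Print_ae j hj)

/-- ★ **(47)′ FOR THE ROUTE'S DENSITY WITH THE INTERIOR INDICATOR, `dV`-a.e., CONSTANTS PULLED OUT, for the v4 χ-package**: for `j ≤ K`, almost every `W`,
`exp(−(E_j − E) − Rm_j)·𝟙[intWindowT3 j](W)·exp(−mainT_j(triv,W) + Pint_j(triv,W)) ≤ resDensity F γ K univ j W` — ✓ `PkgAtV3Chi.le_resDensity_int_ae`'s TEXT with `p.toCore ↦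
p.toRows` (the row the v4 door `…LaneTailV4Chi` reads). [cite: Balaban1985UV3, (47) p.267 + Thm 2 p.272] -/
theorem le_resDensity_int_ae (ha₁ : ∀ i, θBal F.L γ 𝔠.b₀ 𝔠.p₀ i ≤ p.a₁) (j : ℕ) (hj : j ≤ K) :
    ∀ᵐ W ∂fieldMeasure (F.P K) j (Matrix.specialUnitaryGroup (Fin 2) ℂ),
      Real.exp (-(p.toRows.T.Ecst j - p.toRows.E) - p.toRows.T.Rm j) *
          ((AlphaInputsT3AC.intWindowT3 F 𝔠 γ K j).indicator (fun _ => (1 : ℝ)) W *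
            Real.exp (-(p.toRows.T.mainT j (p.toRows.T.triv j) W) + p.toRows.T.Pint j (p.toRows.T.triv j) W)) ≤
        resDensity F γ K Set.univ j W := by
  filter_upwards [p.ineq47Int_ae ha₁ j hj, p.toRows.resDensity_ae_eq j (by omega)] with W hb hW
  rw [hW]
  have hsplit : (AlphaInputsT3AC.intWindowT3 F 𝔠 γ K j).indicator (fun _ => (1 : ℝ)) W *
        Real.exp (-(p.toRows.T.mainT j (p.toRows.T.triv j) W) + p.toRows.T.Pint j (p.toRows.T.triv j) W - p.toRows.T.Ecst j - p.toRows.T.Rm j) =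
      Real.exp (-(p.toRows.T.Ecst j) - p.toRows.T.Rm j) *
        ((AlphaInputsT3AC.intWindowT3 F 𝔠 γ K j).indicator (fun _ => (1 : ℝ)) W *
          Real.exp (-(p.toRows.T.mainT j (p.toRows.T.triv j) W) + p.toRows.T.Pint j (p.toRows.T.triv j) W)) := by
    rw [mul_left_comm, ← Real.exp_add]; congr 2; ring
  have hb' := hb
  change (AlphaInputsT3AC.intWindowT3 F 𝔠 γ K j).indicator (fun _ => (1 : ℝ)) W *
      Real.exp (-(p.toRows.T.mainT j (p.toRows.T.triv j) W) + p.toRows.T.Pint j (p.toRows.T.triv j) W - p.toRows.T.Ecst j - p.toRows.T.Rm j) ≤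
        p.toRows.T.ρ j W at hb'
  rw [hsplit] at hb'
  have hE : Real.exp (-(p.toRows.T.Ecst j - p.toRows.E) - p.toRows.T.Rm j) =
      Real.exp p.toRows.E * Real.exp (-(p.toRows.T.Ecst j) - p.toRows.T.Rm j) := by
    rw [← Real.exp_add]; congr 1; ring
  rw [hE, mul_assoc]
  exact mul_le_mul_of_nonneg_left hb' (Real.exp_nonneg _)

end AlphaInputsT3AC.PkgAtV4Chi

end Api

end Summit.QuantumFields.YangMills.Theorems

end
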